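import Summits.ValiantsHypothesis.ValiantsHypothesis.Theorems.SymPencilEquivariantSdcNotQPYoungDegreeBound
import HarnessLib

/-!
# ValiantsHypothesis / SymPencil — crux `EquivariantSdcNotQP` (stmt-ValiantsHypothesis-17792), line
# `birth_EquivariantSdcNotQP`: the conclusion of `stub_permify` from the spin dichotomy (H1) ALONE

`permify_of_spinDichotomy : (H1) → ⟨conclusion of stub_permify⟩` — composition of
`permify_of_alternatingBounds` ((H1) → (H2) → ⟨stub_permify⟩) with the PROVED (H2)
`youngFixedVector_holds` (Young's rule, completeness of the Specht modules, the tableaux degree inequality).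
So the line `birth_EquivariantSdcNotQP` of crux 17792 rests, as far as `stub_permify` is concerned, on the
single named classical statement (H1): the spin dichotomy for finite groups over `𝔄_n × 𝔄_n` (Schur
multiplier `M(𝔄_n) = ℤ/2`, Hoffman–Humphreys Thm. 2.11; degrees of the spin representations of `2·𝔄_n`,
Thm. 10.7; Schur 1911) — assumed, not in Mathlib.  Helper of the item
(`--supports stmt-ValiantsHypothesis-17792 --as helper`); 0 definitions, 0 named facts.

Honest framing: conditional on (H1); `stub_permify`, the crux `SymPencil.EquivariantSdcNotQP` and
`VP ≠ VNP` remain OPEN; nothing here is progress on `VP ≠ VNP`.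
-/

noncomputable section

set_option linter.dupNamespace false

namespace Summit.ValiantsHypothesis.ValiantsHypothesis.Theorems.SymPencilEquivariantSdcNotQP.YoungBounds

open Literature.NumberTheory.DiophantineGeometry Matrix

open MvPolynomial Literature.Computability.AlgebraicComplexity in
/-- **The conclusion of `stub_permify` ⇐ (H1).**  After this file the line `birth_EquivariantSdcNotQP`
of crux 17792 rests, as far as `stub_permify` is concerned, on the single named classical statement (H1).
Conditional; `stub_permify`, the crux and `VP ≠ VNP` remain OPEN. [folklore] -/
theorem permify_of_spinDichotomy
    (hExt : ∃ a : ℕ, ∀ (n k : ℕ) (E : Type) [Group E] [Finite E]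
      (ψ : E →* ↥(alternatingGroup (Fin n)) × ↥(alternatingGroup (Fin n)))
      (σ : E →* GL (Fin k) ℂ),
      Function.Surjective ψ →
      (∀ g : E, ψ g = 1 → ∃ c : ℂ,
        (σ g : Matrix (Fin k) (Fin k) ℂ) = c • (1 : Matrix (Fin k) (Fin k) ℂ)) →
      n ≤ a * (Nat.log 2 k + 1) ∨
        ∃ θ : E →* ℂˣ, ∀ g : E, ψ g = 1 →
          (σ g : Matrix (Fin k) (Fin k) ℂ) = ((θ g : ℂˣ) : ℂ) • (1 : Matrix (Fin k) (Fin k) ℂ)) :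
    ∃ d : ℕ, ∀ (n m : ℕ) (A : Matrix (Fin m) (Fin m) (MvPolynomial (Fin n × Fin n) ℂ)),
      A.IsSymm → IsEquivariantDetRepr (Subgroup.closure {γ : GL (Fin n × Fin n) ℂ |
        ∃ π ρ : Equiv.Perm (Fin n), (γ : Matrix (Fin n × Fin n) (Fin n × Fin n) ℂ) =
          Equiv.Perm.permMatrix ℂ (Equiv.prodCongr π ρ)}) (perPoly (Fin n) ℂ) A →
      ∃ m' ≤ 2 ^ ((Nat.log 2 m + d) ^ d),
        ∃ A' : Matrix (Fin m') (Fin m') (MvPolynomial (Fin n × Fin n) ℂ),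
          IsAffineDetRepr (perPoly (Fin n) ℂ) A' ∧
          ∀ π ρ : Equiv.Perm (Fin n), ∃ σ : Equiv.Perm (Fin m'),
            A'.map (MvPolynomial.rename fun ij : Fin n × Fin n => (π ij.1, ρ ij.2)) =
              (σ.permMatrix ℂ).map MvPolynomial.C * A' * ((σ.permMatrix ℂ)ᵀ).map MvPolynomial.C :=
  permify_of_alternatingBounds hExt youngFixedVector_holds

end Summit.ValiantsHypothesis.ValiantsHypothesis.Theorems.SymPencilEquivariantSdcNotQP.YoungBounds

end
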